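import Summits.CriticalPhenomena.PercolationContinuityZ3.Theorems.SahiMasterFamilyPointwise
import Summits.CriticalPhenomena.PercolationContinuityZ3.Theorems.SahiMasterFamilyTopCoeffAll
import Literature.Analysis.Approximation.CarberyWrightProofs

/-!
# The pointwise master equality conjecture holds for ALMOST EVERY parameter vector, at every order

Unit `prim-master-conj` (crux anchor stmt-CriticalPhenomena-4575, helper work), gen 13; companion of `SahiMasterFamilyPointwise.lean`, which
shows that the good parameter set is open and dense.  Here the measure-theoretic form: `p ↦ E_k(μ_p; 1_U)` is a real polynomial in the
coordinate probabilities (`sahiEPoly`, gen 3), not identically zero on the unit cube when `U ∉ Z_k` ((EQI-k), gen 12), and **the zero set of a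
real polynomial that does not vanish identically on a convex body is Lebesgue-null** — read off the tree's CARBERY–WRIGHT sublevel bound
(`Literature.Analysis.Approximation.CarberyWright.supSublevelBound_holds`: `(sup_K |P|)^{1/d}·α⁻¹·vol{x ∈ K : |P(x)|^{1/d} ≤ α} ≤ C n`; the zero
set lies in every sublevel set, so its volume is `≤ C n α / (sup_K|P|)^{1/d}` for every `α > 0`).

* `volume_cube_zeroSet_eq_zero` — a polynomial on `ℝⁿ` not vanishing identically on `[0,1]ⁿ` has a Lebesgue-null zero set in `[0,1]ⁿ`;
* `volume_cube_sahiE_zeroSet_eq_zero` — for increasing `U ∉ Z_k` on `n` coordinates, `{x ∈ [0,1]ⁿ : E_k(μ_x; 1_U) = 0}` is Lebesgue-null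
  (product weight `weight x` with real parameters `x ∈ [0,1]ⁿ`; `weight (p ·) = bernoulliWeight p`);
* `ae_sahiE_eq_zero_iff`, `ae_forall_sahiE_eq_zero_iff` — **for Lebesgue-a.e. `x ∈ [0,1]ⁿ`: `E_k(μ_x; 1_U) = 0 ↔ U ∈ Z_k`, simultaneously for all
  increasing `k`-families `U`** (every `k`, every `n`).
So `MasterFamilyEqIff k` (OPEN; it contains Kahn's Conjecture 5) can only fail on a Lebesgue-null, nowhere-dense set of parameters.  Stated on the
cube of `ℝⁿ = Fin n → ℝ` (Lebesgue measure); axioms standard. [this work]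
-/

noncomputable section

open scoped Classical ENNReal

namespace Summit.CriticalPhenomena.PercolationContinuityZ3.Theorems

open Finset Function MeasureTheory
open Literature.Combinatorics.Sahi2008
open Literature.Probability.Percolation.BHK2006 (weight)
open Literature.Probability.Percolation.DecisionTree (ind)

namespace Pointwise

/-! ### Zero sets of polynomials on the cube are null (Carbery–Wright) -/

/-- **A real polynomial on `ℝⁿ` (`n ≥ 1`) that does not vanish identically on the unit cube has a Lebesgue-null zero set in the cube**
(from the Carbery–Wright sublevel-set bound in the tree). [cite: CarberyWright2001, Thm 2 (q = ∞)] -/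
theorem volume_cube_zeroSet_eq_zero {n : ℕ} (hn : 1 ≤ n) (P : MvPolynomial (Fin n) ℝ)
    (hne : ∃ x ∈ Set.pi Set.univ (fun _ : Fin n => Set.Icc (0 : ℝ) 1), MvPolynomial.eval x P ≠ 0) :
    volume {x : Fin n → ℝ | x ∈ Set.pi Set.univ (fun _ : Fin n => Set.Icc (0 : ℝ) 1) ∧ MvPolynomial.eval x P = 0} = 0 := by
  obtain ⟨C, hC, hCW⟩ := Literature.Analysis.Approximation.CarberyWright.supSublevelBound_holds
  set K : Set (Fin n → ℝ) := Set.pi Set.univ (fun _ : Fin n => Set.Icc (0 : ℝ) 1) with hKdef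
  set d : ℕ := max 1 P.totalDegree with hddef
  have hd1 : 1 ≤ d := le_max_left _ _
  have hPd : P.totalDegree ≤ d := le_max_right _ _
  have hKc : IsCompact K := isCompact_univ_pi fun _ => isCompact_Icc
  have hKconv : Convex ℝ K := convex_pi fun _ _ => convex_Icc 0 1
  have hKint : (interior K).Nonempty := by
    refine ⟨fun _ => 1 / 2, ?_⟩
    rw [hKdef, interior_pi_set Set.finite_univ, Set.mem_univ_pi]
    intro i
    rw [interior_Icc, Set.mem_Ioo]
    constructor <;> norm_num
  have hKvol : volume K = 1 := by
    rw [hKdef, volume_pi_pi]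
    simp [Real.volume_Icc]
  set f : (Fin n → ℝ) → ℝ := fun x => |MvPolynomial.eval x P| with hfdef
  have hfc : Continuous f := (MvPolynomial.continuous_eval P).abs
  have hbdd : BddAbove (f '' K) := hKc.bddAbove_image hfc.continuousOn
  set S : ℝ := sSup (f '' K) with hSdef
  have hSpos : 0 < S := by
    obtain ⟨x, hx, hx0⟩ := hne
    exact lt_of_lt_of_le (abs_pos.2 hx0) (le_csSup hbdd ⟨x, hx, rfl⟩)
  have hSd : 0 < S ^ ((1 : ℝ) / d) := Real.rpow_pos_of_pos hSpos _
  have hnpos : (0 : ℝ) < n := by exact_mod_cast hn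
  have hCn : 0 < C * n := mul_pos hC hnpos
  set Z : Set (Fin n → ℝ) := {x | x ∈ K ∧ MvPolynomial.eval x P = 0} with hZdef
  have hZfin : volume Z ≠ ∞ :=
    (lt_of_le_of_lt (measure_mono (fun x hx => hx.1 : Z ⊆ K)) (by rw [hKvol]; exact ENNReal.one_lt_top)).ne
  -- the zero set lies in every sublevel set
  have hbound : ∀ α : ℝ, 0 < α → (volume Z).toReal ≤ C * n * α / S ^ ((1 : ℝ) / d) := by
    intro α hα
    have h := hCW n d hn hd1 P hPd K hKc hKconv hKint hKvol α hα
    set V : Set (Fin n → ℝ) := {x | x ∈ K ∧ |MvPolynomial.eval x P| ^ ((1 : ℝ) / d) ≤ α} with hVdef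
    have hsub : Z ⊆ V := by
      intro x hx
      refine ⟨hx.1, ?_⟩
      rw [hx.2, abs_zero, Real.zero_rpow (by positivity)]
      exact hα.le
    have hVfin : volume V ≠ ∞ :=
      (lt_of_le_of_lt (measure_mono (fun x hx => hx.1 : V ⊆ K)) (by rw [hKvol]; exact ENNReal.one_lt_top)).ne
    have hmono : (volume Z).toReal ≤ (volume V).toReal := ENNReal.toReal_mono hVfin (measure_mono hsub)
    have hα0 : α ≠ 0 := hα.ne'
    have h2 : (volume V).toReal * S ^ ((1 : ℝ) / d) ≤ C * n * α := by
      have h3 := mul_le_mul_of_nonneg_right h hα.le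
      have h4 : S ^ ((1 : ℝ) / d) * α⁻¹ * (volume V).toReal * α = (volume V).toReal * S ^ ((1 : ℝ) / d) := by
        field_simp
      linarith [h3, h4]
    rw [le_div_iff₀ hSd]
    exact le_trans (mul_le_mul_of_nonneg_right hmono hSd.le) h2
  have hV0 : (volume Z).toReal ≤ 0 := by
    refine le_of_forall_pos_le_add fun ε hε => ?_
    have h := hbound (ε * S ^ ((1 : ℝ) / d) / (C * n)) (div_pos (mul_pos hε hSd) hCn)
    rw [zero_add]
    calc (volume Z).toReal ≤ C * n * (ε * S ^ ((1 : ℝ) / d) / (C * n)) / S ^ ((1 : ℝ) / d) := h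
      _ = ε := by field_simp
  have hZ0 : (volume Z).toReal = 0 := le_antisymm hV0 ENNReal.toReal_nonneg
  exact ((ENNReal.toReal_eq_zero_iff _).1 hZ0).resolve_right hZfin

/-! ### The master family: null zero sets off `Z_k` -/

/-- `E_k` under the product weight with real parameters is the evaluation of the polynomial `sahiEPoly`. [this work] -/
theorem eval_sahiEPoly_ind {n k : ℕ} (U : Fin k → Set (Set (Fin n))) (x : Fin n → ℝ) :
    MvPolynomial.eval x (sahiEPoly k (fun j => ind (U j))) = sahiE (weight x) k (fun j => ind (U j)) :=
  eval_sahiEPoly x k _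

/-- **For increasing `U ∉ Z_k` on `n` coordinates, the parameter vectors `x ∈ [0,1]ⁿ` with `E_k(μ_x; 1_U) = 0` form a Lebesgue-null set.**
[this work] -/
theorem volume_cube_sahiE_zeroSet_eq_zero {n k : ℕ} (U : Fin k → Set (Set (Fin n))) (hU : ∀ j, IsUpperSet (U j))
    (hZ : ¬ SuppZeroFlag k U) :
    volume {x : Fin n → ℝ | x ∈ Set.pi Set.univ (fun _ : Fin n => Set.Icc (0 : ℝ) 1) ∧
      sahiE (weight x) k (fun j => ind (U j)) = 0} = 0 := by
  -- `E_k` does not vanish at some parameter vector of the closed cube (indeed at an interior one, by (EQI-k))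
  have hne : ∃ x ∈ Set.pi Set.univ (fun _ : Fin n => Set.Icc (0 : ℝ) 1), sahiE (weight x) k (fun j => ind (U j)) ≠ 0 := by
    by_contra hall
    push Not at hall
    refine hZ ((GluedFrames.masterFamilyIdentEqIff_all k (Fin n) U hU).1 fun p _ => ?_)
    exact hall (fun e => (p e : ℝ)) (Set.mem_univ_pi.2 fun e => (p e).2)
  rcases Nat.lt_or_ge n 1 with hn | hn
  · -- no coordinates: the only parameter vector is a non-zero point, the set is empty
    have hn0 : n = 0 := by omega
    subst hn0
    obtain ⟨x₀, -, hx₀⟩ := hne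
    have hempty : {x : Fin 0 → ℝ | x ∈ Set.pi Set.univ (fun _ : Fin 0 => Set.Icc (0 : ℝ) 1) ∧
        sahiE (weight x) k (fun j => ind (U j)) = 0} = ∅ := by
      ext x
      simp only [Set.mem_setOf_eq, Set.mem_empty_iff_false, iff_false, not_and]
      intro _ h0
      have hx : x = x₀ := funext fun e => Fin.elim0 e
      rw [hx] at h0
      exact hx₀ h0
    rw [hempty]
    exact measure_empty
  · have hne' : ∃ x ∈ Set.pi Set.univ (fun _ : Fin n => Set.Icc (0 : ℝ) 1),
        MvPolynomial.eval x (sahiEPoly k (fun j => ind (U j))) ≠ 0 := by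
      obtain ⟨x, hx, hx0⟩ := hne
      exact ⟨x, hx, by rwa [eval_sahiEPoly_ind]⟩
    have h := volume_cube_zeroSet_eq_zero hn _ hne'
    have hset : {x : Fin n → ℝ | x ∈ Set.pi Set.univ (fun _ : Fin n => Set.Icc (0 : ℝ) 1) ∧
        sahiE (weight x) k (fun j => ind (U j)) = 0} =
        {x : Fin n → ℝ | x ∈ Set.pi Set.univ (fun _ : Fin n => Set.Icc (0 : ℝ) 1) ∧
          MvPolynomial.eval x (sahiEPoly k (fun j => ind (U j))) = 0} := by
      ext x; simp only [Set.mem_setOf_eq, eval_sahiEPoly_ind]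
    rw [hset]
    exact h

/-- **The pointwise master conjecture holds for almost every parameter vector** (one family): for increasing `U` on `n` coordinates and
Lebesgue-a.e. `x`, if `x ∈ [0,1]ⁿ` then `E_k(μ_x; 1_U) = 0 ↔ U ∈ Z_k`. [this work] -/
theorem ae_sahiE_eq_zero_iff {n k : ℕ} (U : Fin k → Set (Set (Fin n))) (hU : ∀ j, IsUpperSet (U j)) :
    ∀ᵐ x ∂(volume : Measure (Fin n → ℝ)), x ∈ Set.pi Set.univ (fun _ : Fin n => Set.Icc (0 : ℝ) 1) →
      (sahiE (weight x) k (fun j => ind (U j)) = 0 ↔ SuppZeroFlag k U) := by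
  by_cases hZ : SuppZeroFlag k U
  · refine Filter.Eventually.of_forall fun x hx => ⟨fun _ => hZ, fun _ => ?_⟩
    have hx' : ∀ e, x e ∈ Set.Icc (0 : ℝ) 1 := fun e => Set.mem_univ_pi.1 hx e
    exact masterFamilyEqIff_mpr k (Fin n) (fun e => ⟨x e, hx' e⟩) U hZ
  · rw [ae_iff]
    refine measure_mono_null (fun x hx => ?_) (volume_cube_sahiE_zeroSet_eq_zero U hU hZ)
    simp only [Set.mem_setOf_eq, Classical.not_imp] at hx
    refine ⟨hx.1, ?_⟩
    by_contra h0
    exact hx.2 ⟨fun h => absurd h h0, fun h => absurd h hZ⟩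

/-- **The pointwise master conjecture holds for almost every parameter vector, simultaneously for all families**: for Lebesgue-a.e.
`x ∈ [0,1]ⁿ`, every increasing `k`-family `U` on `n` coordinates satisfies `E_k(μ_x; 1_U) = 0 ↔ U ∈ Z_k`. [this work] -/
theorem ae_forall_sahiE_eq_zero_iff (n k : ℕ) :
    ∀ᵐ x ∂(volume : Measure (Fin n → ℝ)), x ∈ Set.pi Set.univ (fun _ : Fin n => Set.Icc (0 : ℝ) 1) →
      ∀ U : Fin k → Set (Set (Fin n)), (∀ j, IsUpperSet (U j)) →
        (sahiE (weight x) k (fun j => ind (U j)) = 0 ↔ SuppZeroFlag k U) := by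
  have h : ∀ U : Fin k → Set (Set (Fin n)), ∀ᵐ x ∂(volume : Measure (Fin n → ℝ)),
      x ∈ Set.pi Set.univ (fun _ : Fin n => Set.Icc (0 : ℝ) 1) → (∀ j, IsUpperSet (U j)) →
        (sahiE (weight x) k (fun j => ind (U j)) = 0 ↔ SuppZeroFlag k U) := by
    intro U
    by_cases hU : ∀ j, IsUpperSet (U j)
    · exact (ae_sahiE_eq_zero_iff U hU).mono fun x hx hcube _ => hx hcube
    · exact Filter.Eventually.of_forall fun x _ hU' => absurd hU' hU
  have hall := ae_all_iff.2 h
  exact hall.mono fun x hx hcube U hU => hx U hcube hU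

end Pointwise

end Summit.CriticalPhenomena.PercolationContinuityZ3.Theorems
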